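import Summits.Langlands.Langlands.Theorems.PhantomRMYoshidaResiduallyYoshidaLiftingRibetClassUnique
import HarnessLib

/-!
# No decomposable realiser of a non-trivial residual class — A. Residual Schur and integral rescaling

Lead prover-line-stmt-Langlands-13639-c3-0 (line `sector-klingen-split`, crux `ResiduallyYoshidaLifting`,
stmt-Langlands-13639), skeleton rev 4.  Companion to Ribet's existence theorem `stub_ribetNonsplitLattice` (R1a) and
the uniqueness theorems `realisedClass_unique` / `class_unique_of_intertwiner` of lead c2-0: the GALOIS-SIDE content of
"`Spec R(ρ̄_B)` has no Yoshida (endoscopic) components" (crux strategist census §3 F3(i)).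

**Theorem (`not_blockDiagonal_of_realises_nonsplit`).**  Let `σ, σ' : Γ → GL₂(k)` be irreducible and non-conjugate
over an algebraically closed field `k` of characteristic `p ≠ 2`, `red : ℤ̄_p → k` a ring map, and let
`r : Γ → GL₄(ℚ̄_p)` admit a `ℤ̄_p`-integral frame `rint = P⁻¹ r P` whose reduction through `red` is `GL₄(k)`-conjugate
to the block upper-triangular `(σ, B; 0, σ')` with `B` NOT a coboundary `σ X - X σ'`.  Then NO `GL₄(ℚ̄_p)`-conjugate of
`r` is block-diagonal `τ ⊕ τ'` (`2 + 2`).  In particular the Yoshida-type (decomposable) points `ρ_f ⊕ ρ_g` of the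
ordinary family realise only the trivial class: they are not deformations of the non-split `ρ̄_B`, and an anchor /
propagation argument run on the realisation fibre of `[B] ≠ 0` never meets an endoscopic point.

**Proof** (over the NON-discrete valuation ring `ℤ̄_p`; no lattice theory, no hypothesis on `r` beyond the two
identities).  Suppose `Q⁻¹ r Q = τ ⊕ τ'`.  The idempotent `e = M E M⁻¹` (`M = P⁻¹Q`, `E = 1 ⊕ 0`) of `M₄(ℚ̄_p)`
commutes with every `rint(g)`, `e² = e`, `tr e = 2`.
(A) `e` is INTEGRAL: otherwise rescale by an entry `q` of maximal norm `‖q‖ > 1`; `e₀ = q⁻¹ e` is integral with an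
entry `1` and `e₀² = q⁻¹ e₀`, so its reduction `N ≠ 0` satisfies `N² = 0` and commutes with `ρ̄ = h (σ, B; 0, σ') h⁻¹`;
but the commutant of a NON-SPLIT `(σ, B; 0, σ')` is `k` (`commutant_nonsplit_eq_smul_one`: residual Schur — the
lower-left block intertwines `σ → σ'` hence vanishes, the diagonal blocks are scalars `a, d`, the upper-right block
gives `(a - d) B = σ X - X σ'`, so `a = d` as `B` is not a coboundary, and then `X` intertwines `σ' → σ`, hence `0`),
so `N = a • 1` with `a² = 0`, i.e. `N = 0` — contradiction.
(B) So `ē = red(e)` is an idempotent of the commutant: `ē ∈ {0, 1}`, `tr ē ∈ {0, 4}`; but `tr ē = red(tr e) = 2`,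
forcing `2 = 0` in `k`, i.e. `p = 2`.
Refs: Ribet 1976 Prop. 2.1 (converse direction); Bellaïche–Chenevier 2009 §1.5; Skinner–Wiles 1999 §2 (reducible
deformations of a non-split residual representation are non-split extensions).
-/

noncomputable section

open scoped MatrixGroups

open Matrix IsLocalRing

-- `Summit.Langlands.Langlands.…` (summit = sub-problem name, D-0017 layout) trips `dupNamespace` on every decl.
set_option linter.dupNamespace false
set_option autoImplicit false

namespace Summit.Langlands.Langlands.Cruxes.ResiduallyYoshidaLifting.SectorKlingenSplit.Ribet

open Summit.Langlands.Langlands.Cruxes.ResiduallyYoshidaLifting.EndoscopicCrossingEuler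
open Literature.NumberTheory.GaloisRepresentations

/-! ### Residual Schur: the commutant of a non-split `(σ, B; 0, σ')` is `k` -/

section Residual

variable {k : Type*} [Field k] [IsAlgClosed k] {Γ : Type*} [Group Γ]

/-- **Residual Schur for a non-split extension.**  For `σ, σ' : Γ → GL₂(k)` irreducible and non-conjugate (`k`
algebraically closed) and `B` not a coboundary, every `4 × 4` matrix commuting with all `(σ g, B g; 0, σ' g)` is a
scalar. [cite: BellaicheChenevier2009, §1.5] -/
theorem commutant_nonsplit_eq_smul_one (σ σ' : Γ →* GL (Fin 2) k)
    (hσ : Representation.IsIrreducible ((glStdRepresentation (Fin 2) k).comp σ))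
    (hσ' : Representation.IsIrreducible ((glStdRepresentation (Fin 2) k).comp σ'))
    (hnc : ¬ ∃ u : GL (Fin 2) k, ∀ x, u * σ x * u⁻¹ = σ' x)
    (B : Γ → Matrix (Fin 2) (Fin 2) k)
    (hB : ¬ ∃ X : Matrix (Fin 2) (Fin 2) k, ∀ g, B g = (σ g).val * X - X * (σ' g).val)
    (N : Matrix (Fin 2 ⊕ Fin 2) (Fin 2 ⊕ Fin 2) k)
    (hN : ∀ g, Matrix.fromBlocks (σ g).val (B g) 0 (σ' g).val * N =
      N * Matrix.fromBlocks (σ g).val (B g) 0 (σ' g).val) :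
    ∃ a : k, N = a • (1 : Matrix (Fin 2 ⊕ Fin 2) (Fin 2 ⊕ Fin 2) k) := by
  set N₁₁ := N.toBlocks₁₁
  set N₁₂ := N.toBlocks₁₂
  set N₂₁ := N.toBlocks₂₁
  set N₂₂ := N.toBlocks₂₂
  have hNb : N = Matrix.fromBlocks N₁₁ N₁₂ N₂₁ N₂₂ := (Matrix.fromBlocks_toBlocks N).symm
  have hblk : ∀ g,
      (σ g).val * N₁₁ + B g * N₂₁ = N₁₁ * (σ g).val ∧
      (σ g).val * N₁₂ + B g * N₂₂ = N₁₁ * B g + N₁₂ * (σ' g).val ∧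
      (σ' g).val * N₂₁ = N₂₁ * (σ g).val ∧
      (σ' g).val * N₂₂ = N₂₁ * B g + N₂₂ * (σ' g).val := by
    intro g
    have h := hN g
    rw [hNb, Matrix.fromBlocks_multiply, Matrix.fromBlocks_multiply] at h
    obtain ⟨h11, h12, h21, h22⟩ := Matrix.fromBlocks_inj.mp h
    simp only [Matrix.zero_mul, zero_add, Matrix.mul_zero, add_zero] at h11 h12 h21 h22
    exact ⟨h11, h12, h21, h22⟩
  -- lower-left block: an intertwiner `σ → σ'`, hence zero
  have h21 : N₂₁ = 0 :=
    intertwiner_eq_zero_of_not_conj σ σ' hσ hσ' hnc N₂₁ fun g => (hblk g).2.2.1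
  -- diagonal blocks: scalars
  obtain ⟨a, ha⟩ : ∃ a : k, N₁₁ = a • (1 : Matrix (Fin 2) (Fin 2) k) :=
    intertwiner_eq_smul_one σ hσ N₁₁ fun g => by
      have h := (hblk g).1
      rw [h21, Matrix.mul_zero, add_zero] at h
      exact h
  obtain ⟨d, hd⟩ : ∃ d : k, N₂₂ = d • (1 : Matrix (Fin 2) (Fin 2) k) :=
    intertwiner_eq_smul_one σ' hσ' N₂₂ fun g => by
      have h := (hblk g).2.2.2
      rw [h21, Matrix.zero_mul, zero_add] at h
      exact h
  -- upper-right block: `(a - d) • B g = σ N₁₂ - N₁₂ σ'`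
  have h12 : ∀ g, (a - d) • B g = (σ g).val * N₁₂ - N₁₂ * (σ' g).val := by
    intro g
    have h := (hblk g).2.1
    rw [ha, hd, Matrix.mul_smul, Matrix.mul_one, Matrix.smul_mul, Matrix.one_mul] at h
    rw [sub_smul]
    -- h : σ N₁₂ + d • B = a • B + N₁₂ σ'
    have h' : (σ g).val * N₁₂ - N₁₂ * (σ' g).val = a • B g - d • B g := by
      rw [sub_eq_sub_iff_add_eq_add, h]
    exact h'.symm
  -- `a = d`, since `B` is not a coboundary
  have had : a = d := by
    by_contra had
    have hne : a - d ≠ 0 := sub_ne_zero.mpr had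
    refine hB ⟨(a - d)⁻¹ • N₁₂, fun g => ?_⟩
    rw [Matrix.mul_smul, Matrix.smul_mul, ← smul_sub, ← h12 g, smul_smul, inv_mul_cancel₀ hne, one_smul]
  -- then `N₁₂` intertwines `σ' → σ`, hence vanishes
  have hN12 : N₁₂ = 0 := by
    have hnc' : ¬ ∃ u : GL (Fin 2) k, ∀ x, u * σ' x * u⁻¹ = σ x := by
      rintro ⟨u, hu⟩
      exact hnc ⟨u⁻¹, fun x => by rw [← hu x]; group⟩
    refine intertwiner_eq_zero_of_not_conj σ' σ hσ' hσ hnc' N₁₂ fun g => ?_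
    have h := h12 g
    rw [had, sub_self, zero_smul] at h
    exact (sub_eq_zero.mp h.symm)
  refine ⟨a, ?_⟩
  rw [hNb, ha, hd, h21, hN12, ← had, ← Matrix.fromBlocks_one, Matrix.fromBlocks_smul, smul_zero]

/-- The same with a residual conjugator: a matrix commuting with all `h (σ, B; 0, σ') h⁻¹` (blocks along
`finSumFinEquiv`) is a scalar. [cite: BellaicheChenevier2009, §1.5] -/
theorem residualCommutant_eq_smul_one (σ σ' : Γ →* GL (Fin 2) k)
    (hσ : Representation.IsIrreducible ((glStdRepresentation (Fin 2) k).comp σ))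
    (hσ' : Representation.IsIrreducible ((glStdRepresentation (Fin 2) k).comp σ'))
    (hnc : ¬ ∃ u : GL (Fin 2) k, ∀ x, u * σ x * u⁻¹ = σ' x)
    (B : Γ → Matrix (Fin 2) (Fin 2) k)
    (hB : ¬ ∃ X : Matrix (Fin 2) (Fin 2) k, ∀ g, B g = (σ g).val * X - X * (σ' g).val)
    (h : GL (Fin 4) k) (N : Matrix (Fin 4) (Fin 4) k)
    (hN : ∀ g, (h.val * Matrix.reindex finSumFinEquiv finSumFinEquiv
        (Matrix.fromBlocks (σ g).val (B g) 0 (σ' g).val) * (h⁻¹).val) * N =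
      N * (h.val * Matrix.reindex finSumFinEquiv finSumFinEquiv
        (Matrix.fromBlocks (σ g).val (B g) 0 (σ' g).val) * (h⁻¹).val)) :
    ∃ a : k, N = a • (1 : Matrix (Fin 4) (Fin 4) k) := by
  -- `N' = h⁻¹ N h` commutes with the block forms
  set N' : Matrix (Fin 4) (Fin 4) k := (h⁻¹).val * N * h.val with hN'def
  have hM : ∀ g, Matrix.reindex finSumFinEquiv finSumFinEquiv (Matrix.fromBlocks (σ g).val (B g) 0 (σ' g).val) * N' =
      N' * Matrix.reindex finSumFinEquiv finSumFinEquiv (Matrix.fromBlocks (σ g).val (B g) 0 (σ' g).val) := by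
    intro g
    have e1 : Matrix.reindex finSumFinEquiv finSumFinEquiv (Matrix.fromBlocks (σ g).val (B g) 0 (σ' g).val) * N' =
        (h⁻¹).val * ((h.val * Matrix.reindex finSumFinEquiv finSumFinEquiv
          (Matrix.fromBlocks (σ g).val (B g) 0 (σ' g).val) * (h⁻¹).val) * N) * h.val := by
      simp only [hN'def, Matrix.mul_assoc, Units.inv_mul_cancel_left]
    have e2 : N' * Matrix.reindex finSumFinEquiv finSumFinEquiv (Matrix.fromBlocks (σ g).val (B g) 0 (σ' g).val) =
        (h⁻¹).val * (N * (h.val * Matrix.reindex finSumFinEquiv finSumFinEquiv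
          (Matrix.fromBlocks (σ g).val (B g) 0 (σ' g).val) * (h⁻¹).val)) * h.val := by
      simp only [hN'def, Matrix.mul_assoc, Units.inv_mul, Matrix.mul_one]
    rw [e1, hN g, ← e2]
  -- block coordinates
  have hsub : ∀ X : Matrix (Fin 2 ⊕ Fin 2) (Fin 2 ⊕ Fin 2) k,
      (Matrix.reindex finSumFinEquiv finSumFinEquiv X).submatrix finSumFinEquiv finSumFinEquiv = X := fun X => by
    rw [Matrix.reindex_apply, Matrix.submatrix_submatrix, Equiv.symm_comp_self, Matrix.submatrix_id_id]
  have hsm : ∀ A C : Matrix (Fin 4) (Fin 4) k,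
      (A * C).submatrix ⇑(finSumFinEquiv : Fin 2 ⊕ Fin 2 ≃ Fin (2 + 2)) ⇑(finSumFinEquiv : Fin 2 ⊕ Fin 2 ≃ Fin (2 + 2)) =
        A.submatrix ⇑(finSumFinEquiv : Fin 2 ⊕ Fin 2 ≃ Fin (2 + 2)) ⇑(finSumFinEquiv : Fin 2 ⊕ Fin 2 ≃ Fin (2 + 2)) *
          C.submatrix ⇑(finSumFinEquiv : Fin 2 ⊕ Fin 2 ≃ Fin (2 + 2)) ⇑(finSumFinEquiv : Fin 2 ⊕ Fin 2 ≃ Fin (2 + 2)) :=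
    fun A C => (Matrix.submatrix_mul_equiv A C _ (finSumFinEquiv : Fin 2 ⊕ Fin 2 ≃ Fin (2 + 2)) _).symm
  have hNb : ∀ g, Matrix.fromBlocks (σ g).val (B g) 0 (σ' g).val *
        N'.submatrix ⇑(finSumFinEquiv : Fin 2 ⊕ Fin 2 ≃ Fin (2 + 2)) ⇑(finSumFinEquiv : Fin 2 ⊕ Fin 2 ≃ Fin (2 + 2)) =
      N'.submatrix ⇑(finSumFinEquiv : Fin 2 ⊕ Fin 2 ≃ Fin (2 + 2)) ⇑(finSumFinEquiv : Fin 2 ⊕ Fin 2 ≃ Fin (2 + 2)) *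
        Matrix.fromBlocks (σ g).val (B g) 0 (σ' g).val := by
    intro g
    have hh := congrArg (fun X : Matrix (Fin 4) (Fin 4) k =>
      X.submatrix ⇑(finSumFinEquiv : Fin 2 ⊕ Fin 2 ≃ Fin (2 + 2)) ⇑(finSumFinEquiv : Fin 2 ⊕ Fin 2 ≃ Fin (2 + 2))) (hM g)
    rw [hsm (Matrix.reindex finSumFinEquiv finSumFinEquiv (Matrix.fromBlocks (σ g).val (B g) 0 (σ' g).val)) N',
      hsm N' (Matrix.reindex finSumFinEquiv finSumFinEquiv (Matrix.fromBlocks (σ g).val (B g) 0 (σ' g).val)),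
      hsub] at hh
    exact hh
  obtain ⟨a, ha⟩ := commutant_nonsplit_eq_smul_one σ σ' hσ hσ' hnc B hB _ hNb
  refine ⟨a, ?_⟩
  have hN'a : N' = a • (1 : Matrix (Fin 4) (Fin 4) k) := by
    have e : N' = Matrix.reindex finSumFinEquiv finSumFinEquiv
        (N'.submatrix ⇑(finSumFinEquiv : Fin 2 ⊕ Fin 2 ≃ Fin (2 + 2)) ⇑(finSumFinEquiv : Fin 2 ⊕ Fin 2 ≃ Fin (2 + 2))) := by
      rw [Matrix.reindex_apply, Matrix.submatrix_submatrix, Equiv.self_comp_symm, Matrix.submatrix_id_id]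
    rw [e, ha]
    ext i j
    simp only [Matrix.reindex_apply, Matrix.submatrix_apply, Matrix.smul_apply, Matrix.one_apply,
      EmbeddingLike.apply_eq_iff_eq]
  calc N = h.val * N' * (h⁻¹).val := by
        simp only [hN'def, Matrix.mul_assoc, Units.mul_inv_cancel_left, Units.mul_inv, Matrix.mul_one]
    _ = a • (1 : Matrix (Fin 4) (Fin 4) k) := by
        rw [hN'a, Matrix.mul_smul, Matrix.mul_one, Matrix.smul_mul, Units.mul_inv]

end Residual

/-! ### Integral rescaling of a non-integral matrix -/

section Scaling

variable {p : ℕ} [Fact p.Prime]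

/-- **Integral rescaling, non-integral case.**  A matrix over `ℚ̄_p` with an entry of norm `> 1` is `q • Y₀` with
`‖q‖ > 1`, `Y₀` INTEGRAL and some entry of `Y₀` equal to `1` (divide by an entry of maximal norm). [folklore] -/
theorem exists_integral_rescale_of_one_lt {ι : Type*} [Fintype ι] [DecidableEq ι] (Y : Matrix ι ι (PadicAlgCl p))
    (i₁ j₁ : ι) (hbig : 1 < ‖Y i₁ j₁‖) :
    ∃ (q : PadicAlgCl p) (Y₀ : Matrix ι ι (Valued.integer (PadicAlgCl p))) (i₀ j₀ : ι), q ≠ 0 ∧ 1 < ‖q‖ ∧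
      Y₀.map (Valued.integer (PadicAlgCl p)).subtype = q⁻¹ • Y ∧ Y₀ i₀ j₀ = 1 := by
  obtain ⟨⟨i₀, j₀⟩, -, hmax⟩ := Finset.exists_max_image (Finset.univ : Finset (ι × ι))
    (fun ij => ‖Y ij.1 ij.2‖) (Finset.univ_nonempty_iff.mpr ⟨⟨i₁, j₁⟩⟩)
  set q : PadicAlgCl p := Y i₀ j₀ with hq
  have hle : ∀ i j, ‖Y i j‖ ≤ ‖q‖ := fun i j => hmax ⟨i, j⟩ (Finset.mem_univ _)
  have hq1 : 1 < ‖q‖ := hbig.trans_le (hle i₁ j₁)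
  have hq0 : q ≠ 0 := fun h0 => by
    rw [h0, norm_zero] at hq1
    exact not_lt.mpr zero_le_one hq1
  have hmem : ∀ i j, Y i j / q ∈ Valued.integer (PadicAlgCl p) := by
    intro i j
    rw [mem_integer_iff_norm_le_one, norm_div]
    exact div_le_one_of_le₀ (hle i j) (norm_nonneg _)
  refine ⟨q, Matrix.of fun i j => ⟨_, hmem i j⟩, i₀, j₀, hq0, hq1, ?_, ?_⟩
  · ext i j
    change Y i j / q = q⁻¹ * Y i j
    rw [div_eq_inv_mul]
  · exact Subtype.ext (div_self hq0)

end Scaling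

/-! ### Registered form -/

section Registered

/-- **Registered statement `stub_residualCommutantNonsplit`** (crux stmt-Langlands-13639, line `sector-klingen-split`, skeleton
rev 4): the residual Schur lemma `residualCommutant_eq_smul_one` with explicit binders — the commutant of a realised
NON-split `h (σ, B; 0, σ') h⁻¹` is `k`. [cite: BellaicheChenevier2009, §1.5] -/
theorem stub_residualCommutantNonsplit :
    ∀ (k : Type) [Field k] [IsAlgClosed k] (Γ : Type) [Group Γ] (σ σ' : Γ →* GL (Fin 2) k),
      Representation.IsIrreducible ((Literature.NumberTheory.GaloisRepresentations.glStdRepresentation (Fin 2) k).comp σ) →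
      Representation.IsIrreducible ((Literature.NumberTheory.GaloisRepresentations.glStdRepresentation (Fin 2) k).comp σ') →
      (¬ ∃ u : GL (Fin 2) k, ∀ x, u * σ x * u⁻¹ = σ' x) →
      ∀ (B : Γ → Matrix (Fin 2) (Fin 2) k),
      (¬ ∃ X : Matrix (Fin 2) (Fin 2) k, ∀ g, B g = (σ g).val * X - X * (σ' g).val) →
      ∀ (h : GL (Fin 4) k) (N : Matrix (Fin 4) (Fin 4) k),
      (∀ g, (h.val * Matrix.reindex finSumFinEquiv finSumFinEquiv (Matrix.fromBlocks (σ g).val (B g) 0 (σ' g).val) * (h⁻¹).val) * N =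
        N * (h.val * Matrix.reindex finSumFinEquiv finSumFinEquiv (Matrix.fromBlocks (σ g).val (B g) 0 (σ' g).val) * (h⁻¹).val)) →
      ∃ a : k, N = a • (1 : Matrix (Fin 4) (Fin 4) k) := by
  intro k _ _ Γ _ σ σ' hσ hσ' hnc B hB h N hN
  exact residualCommutant_eq_smul_one σ σ' hσ hσ' hnc B hB h N hN

end Registered

end Summit.Langlands.Langlands.Cruxes.ResiduallyYoshidaLifting.SectorKlingenSplit.Ribet

end
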